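import Literature.AlgebraicGeometry.Morphisms.EtaleLiftDualNumber
import Mathlib.AlgebraicGeometry.Morphisms.Smooth
import Mathlib.RingTheory.Smooth.Basic
import HarnessLib

/-!
# Artinian (nilpotent) lifts of local points: EXIST for smooth morphisms over ANY base, are UNIQUE for étale ones —
# also in the `Over S` spelling of `S`-(group) schemes (the (Q2) token of the (Mc) N3′ tower of cell hodgecm-mathlib)

Topic `Literature/AlgebraicGeometry/Morphisms`; namespace `Literature.AlgebraicGeometry.Morphisms`.  THEOREMS ONLY (no definition,
no named fact, no instance, no notation, no `sorry`).

THE PRINT.  [EGAIV4] Déf. (17.1.1) ∕ Prop. (17.1.6) ∕ Déf. (17.3.1): a smooth (resp. étale) morphism `f : Y → S` is formally smooth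
(resp. formally étale): for every AFFINE `S`-scheme `Spec R′` and every closed subscheme `Spec R ↪ Spec R′` defined by a NILPOTENT ideal,
`Hom_S(Spec R′, Y) → Hom_S(Spec R, Y)` is surjective (resp. bijective) — [StacksProject, Tag 02H6] «a smooth morphism is formally smooth»,
[SGA1, Exp. III Cor. 5.2 and Exp. I Cor. 5.6].  [MumfordAV1970] §13, proof of the Theorem (p. 125): «since `X̂` is non-singular, `g` lifts
to `R′`» — the use made of it by the dual-abelian-scheme line (R′ ↠ R a small extension of Artinian local rings).

THE TREE (★, imported or re-run, never restated): ★ `Motives/SmoothThickeningLift.exists_lift_of_smooth_of_isNilpotent` is the smooth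
lifting for LOCAL test rings over a base `Spec K` with `K` a FIELD (stalk road: `𝒪_{Y,y}` is formally smooth over the base, Mathlib
`Scheme.Hom.smoothLocus_eq_top` + `Algebra.FormallySmooth.liftOfSurjective`); the field enters only through «`K → 𝒪_{Spec K, f y}` is a
localisation», which holds for every commutative ring.  ★ `Morphisms/EtaleLiftDualNumber.exists_unique_lift_of_etale_of_isNilpotent` is
the étale uniqueness for ANY `f` and ANY surjection with nilpotent kernel.  This file supplies:

* §1 `exists_lift_of_smooth_of_isNilpotent_affineBase` — the ★ stalk proof re-run over an AFFINE base `Spec R₀`, `R₀` ANY commutative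
  ring: `f : Y → Spec R₀` smooth, `R` local, `π : R′ ↠ R` with nilpotent kernel, `g : Spec R → Y` over `s : Spec R′ → Spec R₀` ⇒ a lift
  `g′ : Spec R′ → Y` with `Spec π ≫ g′ = g`, `g′ ≫ f = s`;
* §2 `exists_lift_of_smooth_of_isNilpotent` (namespace `Morphisms`) — the same over an ARBITRARY base scheme `S` (`R′` local): the
  one-point test schemes factor through an affine open `Spec R₀ ↪ S` around `f (g 𝔪)` (Mathlib `Scheme.exists_affine_mem_range_and_range_subset`,
  `Scheme.preimage_eq_top_of_closedPoint_mem`, `IsOpenImmersion.lift`) and §1 applies to the base change `Y ×_S Spec R₀ → Spec R₀`;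
* §3 the `Over S` packaging consumed by the (Mc) N3′ sub-line of `Cruxes/HDel/Lines/F3DualAbelianSchemeMc` (S-e plan, token
  (Q2) «Artinian lifts — étale: unique»): `Over.exists_lift_of_smooth_of_isNilpotent` (any `X : Over S` with `Smooth X.hom`, any
  base), `Over.existsUnique_lift_of_etale_of_isNilpotent` (unique lift through an étale `π : X₁ → X₂` over `S`),
  `Over.eq_of_etale_of_isNilpotent` (two `C′`-points of `X₁` with the same reduction and the same image under `π` are equal — the
  shape the S-e assembly consumes) and the KERNEL form `Over.existsUnique_one_lift_of_etale_of_isNilpotent` for a homomorphism of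
  `S`-monoid schemes («a `C′`-point of `X₂` reducing to `1` lifts uniquely to a `C′`-point of `X₁` reducing to `1` with image the
  given one»).  The letter S-a `stub_F3McN3Sa` itself («lifts exist for `Â′ → S′`», affine `S′`) is closed by the sibling ★-candidate
  `Deformation/MorphismLiftsSquareZeroSmoothLocal.exists_over_lift_of_smooth_smallExtension` (B-p02 (g17), bytes of record); §2 here is
  the any-base generic form.

Cell hodgecm-mathlib (D-0151 ∕ FLOOR 0), P1 (Mc) N3′ J1; PROOF lane, count-neutral generic capital.  HC_CM is proved only modulo the 7
printed citations until rung 0 closes; nothing here is about HC.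

Mathlib used: `Smooth` (`HasRingHomProperty`; base change `pullback.snd`), `Scheme.Hom.smoothLocus_eq_top`∕`mem_smoothLocus`,
`Scheme.stalkClosedPointTo`, `Scheme.Spec_stalkClosedPointTo_fromSpecStalk`, `Scheme.SpecMap_stalkMap_fromSpecStalk`,
`Spec.fromSpecStalk_eq'`, `StructureSheaf.toStalk` + `Algebra.FormallySmooth.of_isLocalization`, `Algebra.FormallySmooth.liftOfSurjective`,
`IsLocalRing.of_surjective'`, `IsLocalHom.of_surjective`, `Spec_closedPoint`, `Scheme.preimage_eq_top_of_closedPoint_mem`,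
`Scheme.exists_affine_mem_range_and_range_subset`, `IsOpenImmersion.lift(_fac)`, `pullback.lift(_fst,_snd)`, `Over.homMk`,
`Over.OverMorphism.ext`, `MonObj.one_comp`∕`comp_one`.

## References
* [EGAIV4] A. Grothendieck, J. Dieudonné, *Éléments de géométrie algébrique* IV₄, Publ. Math. IHÉS 32 (1967): Déf. (17.1.1), Prop. (17.1.6),
  Déf. (17.3.1).
* [StacksProject] The Stacks Project, Tag 02H6 (Lemma 37.11.7, infinitesimal lifting criterion) and Tag 02GZ (formally smooth morphisms).
* [SGA1] A. Grothendieck, M. Raynaud, *Revêtements étales et groupe fondamental*, LNM 224 (1971): Exp. I Cor. 5.6, Exp. III Cor. 5.2.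
* [MumfordAV1970] D. Mumford, *Abelian Varieties* (1970): §13, proof of the Theorem, pp. 125–126.
-/

universe u

open CategoryTheory CategoryTheory.Limits AlgebraicGeometry MonoidalCategory CartesianMonoidalCategory
open scoped MonObj

noncomputable section

namespace Literature.AlgebraicGeometry.Morphisms

/-! ## §1 Smooth ⇒ local points lift along nilpotent thickenings — affine base `Spec R₀`, `R₀` any commutative ring -/

/-- The structure map `R₀ → 𝒪_{Spec R₀, p}` of a stalk of `Spec R₀` is formally smooth (it is a localisation map).
[cite: StacksProject, Tag 02H6] -/
private theorem formallySmooth_toStalk (R₀ : CommRingCat.{u}) (p : PrimeSpectrum R₀) :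
    (StructureSheaf.toStalk R₀ p).hom.FormallySmooth := by
  have h : Algebra.FormallySmooth R₀ ((Spec.structureSheaf R₀).presheaf.stalk p) :=
    Algebra.FormallySmooth.of_isLocalization p.asIdeal.primeCompl
  exact RingHom.formallySmooth_algebraMap.mpr h

/-- **Smooth ⇒ infinitesimal lifting of local points, affine base** ([EGAIV4] Prop. (17.1.6) with Déf. (17.3.1); [StacksProject]
Tag 02H6): let `f : Y → Spec R₀` be smooth (`R₀` any commutative ring), `R` a local ring, `π : R′ → R` a surjective ring
homomorphism with nilpotent kernel, `s : Spec R′ → Spec R₀` and `g : Spec R → Y` with `g ≫ f = Spec.map π ≫ s`.  Then there is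
`g′ : Spec R′ → Y` with `Spec.map π ≫ g′ = g` and `g′ ≫ f = s`.  (The ★ `Motives/SmoothThickeningLift` stalk road with the field
replaced by a ring: `g = Spec φ ≫ Y.fromSpecStalk y`, `𝒪_{Y,y}` formally smooth over `R₀`, Mathlib
`Algebra.FormallySmooth.liftOfSurjective`.) [cite: EGAIV4, Déf. (17.1.1), Prop. (17.1.6) and Déf. (17.3.1)]
[cite: StacksProject, Tag 02H6] [cite: MumfordAV1970, §13 (proof of the Thm. p. 125)] -/
theorem exists_lift_of_smooth_of_isNilpotent_affineBase {R₀ : CommRingCat.{u}} {Y : Scheme.{u}} (f : Y ⟶ Spec R₀) [Smooth f]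
    {R R' : CommRingCat.{u}} [IsLocalRing R] (π : R' ⟶ R) (hπ : Function.Surjective π.hom)
    (hnil : IsNilpotent (RingHom.ker π.hom)) (s : Spec R' ⟶ Spec R₀) (g : Spec R ⟶ Y)
    (w : g ≫ f = Spec.map π ≫ s) :
    ∃ g' : Spec R' ⟶ Y, Spec.map π ≫ g' = g ∧ g' ≫ f = s := by
  classical
  -- the closed point of `Spec R`, its image `y`, and the local homomorphism `φ : 𝒪_{Y,y} → R`
  set y : Y := g (IsLocalRing.closedPoint R) with hy
  let φ : Y.presheaf.stalk y ⟶ R := Scheme.stalkClosedPointTo g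
  have hφ : Spec.map φ ≫ Y.fromSpecStalk y = g := Scheme.Spec_stalkClosedPointTo_fromSpecStalk g
  -- the `R₀`-structures: `σ' : R₀ → R'` with `s = Spec.map σ'`, `ψ : R₀ → 𝒪_{Y,y}`
  let σ' : R₀ ⟶ R' := Spec.preimage s
  have hσ' : Spec.map σ' = s := Spec.map_preimage s
  let τ : R₀ ⟶ (Spec R₀).presheaf.stalk (f y) := StructureSheaf.toStalk R₀ (f y)
  have hτ : (Spec R₀).fromSpecStalk (f y) = Spec.map τ := Spec.fromSpecStalk_eq' _ _
  let ψ : R₀ ⟶ Y.presheaf.stalk y := τ ≫ f.stalkMap y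
  -- `𝒪_{Y,y}` is formally smooth over `R₀`
  have hψ : ψ.hom.FormallySmooth := by
    have h1 : (f.stalkMap y).hom.FormallySmooth := by
      rw [← Scheme.Hom.mem_smoothLocus, Scheme.Hom.smoothLocus_eq_top]; trivial
    exact (formallySmooth_toStalk R₀ (f y)).comp h1
  -- the compatibility `φ ∘ ψ = π ∘ σ'` read off `g ≫ f = Spec.map π ≫ s`
  have hcomp : ψ ≫ φ = σ' ≫ π := by
    rw [← Spec.map_inj]
    simp only [Spec.map_comp, Category.assoc, ψ]
    rw [← hτ, Scheme.SpecMap_stalkMap_fromSpecStalk, reassoc_of% hφ, hσ', w]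
  -- algebra structures and the formally smooth lift
  letI algA : Algebra R₀ (Y.presheaf.stalk y) := ψ.hom.toAlgebra
  letI algB : Algebra R₀ R' := σ'.hom.toAlgebra
  letI algC : Algebra R₀ R := (σ' ≫ π).hom.toAlgebra
  haveI : Algebra.FormallySmooth R₀ (Y.presheaf.stalk y) := hψ
  let gₐ : R' →ₐ[R₀] R := { π.hom with commutes' := fun _ => rfl }
  let fₐ : Y.presheaf.stalk y →ₐ[R₀] R :=
    { φ.hom with
      commutes' := fun k => by
        change φ.hom (ψ.hom k) = (σ' ≫ π).hom k
        rw [← CommRingCat.comp_apply, hcomp] }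
  have hnil' : IsNilpotent (RingHom.ker (gₐ : R' →+* R)) := hnil
  let φ' : Y.presheaf.stalk y →ₐ[R₀] R' := Algebra.FormallySmooth.liftOfSurjective fₐ gₐ hπ hnil'
  have hφ' : gₐ.comp φ' = fₐ := Algebra.FormallySmooth.comp_liftOfSurjective fₐ gₐ hπ hnil'
  refine ⟨Spec.map (CommRingCat.ofHom φ'.toRingHom) ≫ Y.fromSpecStalk y, ?_, ?_⟩
  · -- `Spec.map π ≫ g' = g`
    have e : CommRingCat.ofHom φ'.toRingHom ≫ π = φ := by
      ext x
      exact AlgHom.congr_fun hφ' x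
    rw [← Spec.map_comp_assoc, e, hφ]
  · -- `g' ≫ f = s`
    have e : ψ ≫ CommRingCat.ofHom φ'.toRingHom = σ' := by
      ext k
      exact φ'.commutes k
    rw [Category.assoc, ← Scheme.SpecMap_stalkMap_fromSpecStalk, hτ, ← Spec.map_comp_assoc,
      ← Spec.map_comp]
    change Spec.map (ψ ≫ CommRingCat.ofHom φ'.toRingHom) = s
    rw [e, hσ']

/-! ## §2 Smooth ⇒ local points lift along nilpotent thickenings — arbitrary base `S` -/

/-- **Smooth ⇒ infinitesimal lifting of local points, ANY base** ([EGAIV4] Prop. (17.1.6) ∕ Déf. (17.3.1); [StacksProject] Tag 02H6;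
[MumfordAV1970] §13 p. 125 «since `X̂` is non-singular, `g` lifts to `R′`»): let `f : Y → S` be smooth, `R′` a LOCAL ring,
`π : R′ → R` surjective with nilpotent kernel (so `R` is local too), `s : Spec R′ → S` and `g : Spec R → Y` with
`g ≫ f = Spec.map π ≫ s`.  Then there is `g′ : Spec R′ → Y` with `Spec.map π ≫ g′ = g` and `g′ ≫ f = s`.  Reduction to §1: the
one-point test schemes factor through an affine open `Spec R₀ ↪ S` around `f (g 𝔪)`, and `Y ×_S Spec R₀ → Spec R₀` is smooth.
[cite: EGAIV4, Déf. (17.1.1), Prop. (17.1.6) and Déf. (17.3.1)] [cite: StacksProject, Tag 02H6]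
[cite: MumfordAV1970, §13 (proof of the Thm. p. 125)] -/
theorem exists_lift_of_smooth_of_isNilpotent {Y S : Scheme.{u}} (f : Y ⟶ S) [Smooth f]
    {R R' : CommRingCat.{u}} [IsLocalRing R'] (π : R' ⟶ R) (hπ : Function.Surjective π.hom)
    (hnil : IsNilpotent (RingHom.ker π.hom)) (s : Spec R' ⟶ S) (g : Spec R ⟶ Y)
    (w : g ≫ f = Spec.map π ≫ s) :
    ∃ g' : Spec R' ⟶ Y, Spec.map π ≫ g' = g ∧ g' ≫ f = s := by
  classical
  -- `R` is local (a quotient of the local ring `R'`; it is nontrivial since `ker π` is nilpotent)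
  haveI : Nontrivial R := by
    by_contra hR
    rw [not_nontrivial_iff_subsingleton] at hR
    obtain ⟨n, hn⟩ := hnil
    have h1 : (1 : R') ∈ RingHom.ker π.hom := by
      rw [RingHom.mem_ker]; exact Subsingleton.elim _ _
    have h2 : (1 : R') ∈ RingHom.ker π.hom ^ n := by simpa using Ideal.pow_mem_pow h1 n
    rw [hn, Submodule.zero_eq_bot, Ideal.mem_bot] at h2
    exact one_ne_zero h2
  haveI : IsLocalRing R := IsLocalRing.of_surjective' π.hom hπ
  haveI : IsLocalHom π.hom := IsLocalHom.of_surjective π.hom hπ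
  -- the point `x = f (g 𝔪) = s 𝔪'` and an affine open `j : Spec R₀ ↪ S` around it
  set y : Y := g (IsLocalRing.closedPoint R) with hy
  have hx : s (IsLocalRing.closedPoint R') = f y := by
    rw [hy, ← Scheme.Hom.comp_apply, w, Scheme.Hom.comp_apply, Spec_closedPoint]
  obtain ⟨R₀, j, hj, hxj, -⟩ :=
    Scheme.exists_affine_mem_range_and_range_subset (X := S) (x := f y) (U := ⊤)
      (TopologicalSpace.Opens.mem_top (f y))
  haveI := hj
  -- `s` factors through `j`
  have hsr : Set.range s ⊆ Set.range j := by
    have htop : s ⁻¹ᵁ j.opensRange = ⊤ :=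
      Scheme.preimage_eq_top_of_closedPoint_mem s (U := j.opensRange) (by rw [hx]; exact hxj)
    rintro _ ⟨t, rfl⟩
    have ht : t ∈ s ⁻¹ᵁ j.opensRange := by rw [htop]; trivial
    exact ht
  let s₀ : Spec R' ⟶ Spec R₀ := IsOpenImmersion.lift j s hsr
  have hs₀ : s₀ ≫ j = s := IsOpenImmersion.lift_fac j s hsr
  -- `g` factors through the base change `Y ×_S Spec R₀`
  have wg : g ≫ f = (Spec.map π ≫ s₀) ≫ j := by rw [Category.assoc, hs₀, w]
  let g₀ : Spec R ⟶ pullback f j := pullback.lift g (Spec.map π ≫ s₀) wg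
  have w₀ : g₀ ≫ pullback.snd f j = Spec.map π ≫ s₀ := pullback.lift_snd _ _ _
  -- §1 for the smooth morphism `Y ×_S Spec R₀ → Spec R₀`
  obtain ⟨g₁, h₁, h₂⟩ :=
    exists_lift_of_smooth_of_isNilpotent_affineBase (pullback.snd f j) π hπ hnil s₀ g₀ w₀
  refine ⟨g₁ ≫ pullback.fst f j, ?_, ?_⟩
  · rw [← Category.assoc, h₁]
    exact pullback.lift_fst _ _ _
  · rw [Category.assoc, pullback.condition, ← Category.assoc, h₂, hs₀]

/-! ## §3 The `Over S` packaging: `S`-schemes, abelian schemes, `S`-group schemes -/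

/-- **Lifts over `S`**: for an `S`-scheme `X` with `X → S` smooth, a local ring `C′`, a surjection `q : C′ ↠ C` with nilpotent
kernel, a structure map `c′ : Spec C′ → S` and the bound `S`-morphism `ι₀ : Spec C → Spec C′` (`ι₀.left = Spec q`), every
`S`-morphism `g : Spec C → X` extends along `ι₀`: `∃ g′ : Spec C′ → X` over `S` with `ι₀ ≫ g′ = g`.
[cite: EGAIV4, Prop. (17.1.6) and Déf. (17.3.1)] [cite: StacksProject, Tag 02H6] -/
theorem Over.exists_lift_of_smooth_of_isNilpotent {S : Scheme.{u}} (X : Over S) [Smooth X.hom]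
    {C' C : Type u} [CommRing C'] [IsLocalRing C'] [CommRing C] (q : C' →+* C) (hq : Function.Surjective q)
    (hnil : IsNilpotent (RingHom.ker q)) (c' : Spec (.of C') ⟶ S)
    (ι₀ : Over.mk (Spec.map (CommRingCat.ofHom q) ≫ c') ⟶ Over.mk c') (hι : ι₀.left = Spec.map (CommRingCat.ofHom q))
    (g : Over.mk (Spec.map (CommRingCat.ofHom q) ≫ c') ⟶ X) :
    ∃ g' : Over.mk c' ⟶ X, ι₀ ≫ g' = g := by
  obtain ⟨g₁, h₁, h₂⟩ :=
    _root_.Literature.AlgebraicGeometry.Morphisms.exists_lift_of_smooth_of_isNilpotent X.hom (CommRingCat.ofHom q) hq hnil c' g.left (Over.w g)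
  refine ⟨Over.homMk g₁ h₂, Over.OverMorphism.ext ?_⟩
  rw [Over.comp_left, hι]
  exact h₁

/-- **Unique lifts through an ÉTALE `S`-morphism** ([EGAIV4] Déf. (17.1.1)∕(17.3.1), [SGA1] I Cor. 5.6 — the tree's ★
`exists_unique_lift_of_etale_of_isNilpotent` in the `Over S` spelling): for `π : X₁ → X₂` over `S` with `π` étale, a surjection
`q : C′ ↠ C` with nilpotent kernel (no locality needed), `c′ : Spec C′ → S`, the bound `ι₀ : Spec C → Spec C′` over `S`, and a
commutative square `b ≫ π = ι₀ ≫ a` (`b : Spec C → X₁`, `a : Spec C′ → X₂` over `S`), there is a UNIQUE `k : Spec C′ → X₁` over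
`S` with `ι₀ ≫ k = b` and `k ≫ π = a`. [cite: EGAIV4, Déf. (17.1.1) and Déf. (17.3.1)] [cite: SGA1, Exp. I Cor. 5.6] -/
theorem Over.existsUnique_lift_of_etale_of_isNilpotent {S : Scheme.{u}} {X₁ X₂ : Over S} (π : X₁ ⟶ X₂) [Etale π.left]
    {C' C : Type u} [CommRing C'] [CommRing C] (q : C' →+* C) (hq : Function.Surjective q)
    (hnil : IsNilpotent (RingHom.ker q)) (c' : Spec (.of C') ⟶ S)
    (ι₀ : Over.mk (Spec.map (CommRingCat.ofHom q) ≫ c') ⟶ Over.mk c') (hι : ι₀.left = Spec.map (CommRingCat.ofHom q))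
    (b : Over.mk (Spec.map (CommRingCat.ofHom q) ≫ c') ⟶ X₁) (a : Over.mk c' ⟶ X₂) (h : b ≫ π = ι₀ ≫ a) :
    ∃! k : Over.mk c' ⟶ X₁, ι₀ ≫ k = b ∧ k ≫ π = a := by
  have hsq : b.left ≫ π.left = Spec.map (CommRingCat.ofHom q) ≫ a.left := by
    have e := congrArg Over.Hom.left h
    rw [Over.comp_left, Over.comp_left, hι] at e
    exact e
  obtain ⟨k₁, ⟨hk₁, hk₂⟩, huniq⟩ :=
    exists_unique_lift_of_etale_of_isNilpotent π.left (CommRingCat.ofHom q) hq hnil a.left b.left hsq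
  have wk : k₁ ≫ X₁.hom = c' := by
    rw [← Over.w π, ← Category.assoc, hk₂]
    exact Over.w a
  refine ⟨Over.homMk k₁ wk, ⟨Over.OverMorphism.ext ?_, Over.OverMorphism.ext ?_⟩, ?_⟩
  · rw [Over.comp_left, hι]
    exact hk₁
  · rw [Over.comp_left]
    exact hk₂
  · rintro k ⟨hk₁', hk₂'⟩
    refine Over.OverMorphism.ext ?_
    have e₁ := congrArg Over.Hom.left hk₁'
    rw [Over.comp_left, hι] at e₁
    have e₂ := congrArg Over.Hom.left hk₂'
    rw [Over.comp_left] at e₂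
    exact huniq k.left ⟨e₁, e₂⟩

/-- **Two lifts through an étale `S`-morphism with the same reduction and the same image coincide** (the uniqueness half of
`Over.existsUnique_lift_of_etale_of_isNilpotent`, in the shape the (Mc) N3′ S-e assembly consumes: `k₁ k₂ : Spec C′ → X₁` over `S`,
`ι₀ ≫ k₁ = ι₀ ≫ k₂`, `k₁ ≫ π = k₂ ≫ π` ⇒ `k₁ = k₂`). [cite: EGAIV4, Déf. (17.1.1) and Déf. (17.3.1)] [cite: SGA1, Exp. I Cor. 5.6] -/
theorem Over.eq_of_etale_of_isNilpotent {S : Scheme.{u}} {X₁ X₂ : Over S} (π : X₁ ⟶ X₂) [Etale π.left]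
    {C' C : Type u} [CommRing C'] [CommRing C] (q : C' →+* C) (hq : Function.Surjective q)
    (hnil : IsNilpotent (RingHom.ker q)) (c' : Spec (.of C') ⟶ S)
    (ι₀ : Over.mk (Spec.map (CommRingCat.ofHom q) ≫ c') ⟶ Over.mk c') (hι : ι₀.left = Spec.map (CommRingCat.ofHom q))
    (k₁ k₂ : Over.mk c' ⟶ X₁) (h₀ : ι₀ ≫ k₁ = ι₀ ≫ k₂) (hπ : k₁ ≫ π = k₂ ≫ π) : k₁ = k₂ := by
  obtain ⟨k, -, huniq⟩ := Over.existsUnique_lift_of_etale_of_isNilpotent π q hq hnil c' ι₀ hι (ι₀ ≫ k₂) (k₂ ≫ π)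
    (by rw [Category.assoc])
  exact (huniq k₁ ⟨h₀, hπ⟩).trans (huniq k₂ ⟨rfl, rfl⟩).symm

/-- **Unique lifts through an étale HOMOMORPHISM of `S`-group schemes, kernel form** (the (Q2) token of the (Mc) N3′ S-e plan:
«`η ∈ ker (X₂(C′) → X₂(C))` lifts uniquely to `k ∈ ker (X₁(C′) → X₁(C))` with `k ≫ π = η`»): for `S`-monoid schemes `X₁, X₂`,
a homomorphism `π : X₁ → X₂` with `π` étale, and a `C′`-point `a` of `X₂` over `S` reducing to `1` modulo the nilpotent ideal
`ker q`, there is a unique `C′`-point `k` of `X₁` reducing to `1` with `k ≫ π = a`. [cite: EGAIV4, Déf. (17.1.1) and Déf. (17.3.1)]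
[cite: SGA1, Exp. I Cor. 5.6] [cite: MumfordAV1970, §13 (proof of the Thm. pp. 125–130)] -/
theorem Over.existsUnique_one_lift_of_etale_of_isNilpotent {S : Scheme.{u}} {X₁ X₂ : Over S} [MonObj X₁] [MonObj X₂]
    (π : X₁ ⟶ X₂) [IsMonHom π] [Etale π.left]
    {C' C : Type u} [CommRing C'] [CommRing C] (q : C' →+* C) (hq : Function.Surjective q)
    (hnil : IsNilpotent (RingHom.ker q)) (c' : Spec (.of C') ⟶ S)
    (ι₀ : Over.mk (Spec.map (CommRingCat.ofHom q) ≫ c') ⟶ Over.mk c') (hι : ι₀.left = Spec.map (CommRingCat.ofHom q))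
    (a : Over.mk c' ⟶ X₂) (ha : ι₀ ≫ a = 1) :
    ∃! k : Over.mk c' ⟶ X₁, ι₀ ≫ k = 1 ∧ k ≫ π = a :=
  Over.existsUnique_lift_of_etale_of_isNilpotent π q hq hnil c' ι₀ hι 1 a (by rw [MonObj.one_comp, ha])

end Literature.AlgebraicGeometry.Morphisms

end
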